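/-
Copyright: statement-level skeleton of a published paper (lit-balaban cell, Phase-2 proof seat p26 gen 45). No claims beyond
what the kernel checks below.
-/
import Mathlib
import Literature.MathematicalPhysics.QuantumFieldTheory.Balaban1983to89.B3Sect3KernelsZeroTorus
import Literature.MathematicalPhysics.QuantumFieldTheory.Balaban1983to89.B3Ineq210RegularZeroBridge
import Literature.MathematicalPhysics.QuantumFieldTheory.Balaban1983to89.B3Eq326FromFeynmanRules
import Literature.MathematicalPhysics.QuantumFieldTheory.Balaban1983to89.B3Eq213TorusBoxSeam

/-!
# B3 — T. Bałaban, *(Higgs)₂,₃ quantum fields in a finite volume. III. Renormalization*, CMP **88** (1983) 411–445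
[Balaban1983Higgs3] — p. 424 [PDF 14] (2.6) and p. 426 [PDF 16] (2.10): **THE SCALE PIECES `G^η_{(j)}` AND THEIR BOUNDS (2.10) AT
ZERO BACKGROUND, ON THE (HIGGS)₂,₃ CARRIER `HiggsLattice.Site P 0`** — the carrier on which the Feynman-rule evaluator of this
lineage (FILEs 1–15: `B3GraphAmplitude`, `B3GraphAmplitudeRules`, …, `B3DifferentiatedLineKernels`), p18's graphs and the packaging
into p19's `B3Ineq213Amplitude.Amp` (FILE 12 §7) live.  The tree PROVES (2.10) for the zero-field torus model instance on the
carrier of Bałaban's scalar torus tower (`Setup`'s `Site Q 0`: p03's `B3Ineq210ZeroTorus.ineq210_zeroTorus`, p20's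
`B3Ineq210MixedTorus.ineq210_mixed_zeroTorus_rpow`, packaged as Sect.-3 kernels by p20's `B3Sect3KernelsZeroTorus`); the (Higgs)₂,₃
model's own torus `T_ε` (typer's `HiggsLattice`) is identified with that carrier on the sub-family of tori with equal periods a power of
`L` by p14's `B1Eq211ZeroFieldTorusLevels.eSiteAt` (level-`k` `Setup` torus `setupAt S k`, `η = L^{−k}` = B3 (1.1)), under which the
model's propagator (I.2.20) at zero field IS `(L^kε)²·G_k` of the tower (p14's `B1Eq220ZeroFieldTorusLevels.propagatorK_zero_eq_at`)
and the printed torus distance (I.1.3) IS the tower lineage's sup distance (`T_eSiteAt`); p33's `B3Ineq210RegularZeroBridge` transfers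
`ScaledKernels.Ineq210` along it between p03's carrier and r14's covariant carrier `B3Ineq210RegularTorus.regTorusKernels` at `A = 0`
(column-sum norms of the `N × N` colour blocks) and re-assembles p03's theorem over a mass window.  This file (FILE 16 of the evaluator
lineage) reads the same identification IN THE EVALUATOR'S VOCABULARY: the pieces as explicit symmetric matrices on the (Higgs)₂,₃
carrier, their matrix entries on FILE 2's basis fields `δ_x ⊗ e_i` (the free-kernel shape `C₀ ⊗ 1_N` of the `_print` theorems of
FILEs 11/13) identified with r14's pieces of record at zero field, and the four difference quotients of FILE 6 ∕ FILE 5 (`dKernelL` ∕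
`dKernelR` ∕ `d2KernelT` ∕ `dKernelT`) with their (2.10) bounds — including the second endpoint and the clause with one differentiation
at each end (p20), which p33's bridge does not carry — in the model's printed distance `HiggsLattice.Site.tdist`.

statement-level skeleton of published theorems with citation tags; proofs where landed; nothing here is a claim about
the Yang–Mills mass gap

PDF held: `paper:balaban1983-higgs-2-3-quantum-fields-finite-volume` (journal page = PDF page + 410); p. 412 [PDF 2] ((1.1)),
p. 424 [PDF 14] ((2.6)) and p. 426 [PDF 16] ((2.10)) read by this seat on the text layer
`~/.lit/texts/paper-balaban1983-higgs-2-3-quantum-fields-finite-volume/p0002.txt`, `p0016.txt` (2026-08-24).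

CITATION HEADER (lean-in-tree rule).  lit-balaban TYPED SKELETON (HOME `run/shared/lean/pub/lit-balaban/`), PHASE 2, seat p26 gen 45
(unit `lit-balaban-p26`; free-target protocol G.5-34(d), own lane — item 5(i) `K_le` of `HOME/lit-balaban-p26/DESIGN-B3-evaluator.md`,
the CARRIER BRIDGE scoped there at gen 44).  ROWS **B3.Eq2.6**, **B3.Eq2.10** (heads `proved`: p03's `B3Ineq210ZeroTorus`, r14's
`B3Ineq210RegularTorus` and their twins) and **B3.Eq2.13-2.14** (the `K_le` inputs of FILE 12 ∕ FILE 14) of `HOME/lit-balaban-r15/ROWS-B3.md`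
(fold owner r15; this file is an OPTIONAL located member, cells only, zero head weight).  CONSUMES BY NAME, nothing re-declared: p03's
`B3Ineq210ZeroTorus.{pieceT, sum_pieceT, zeroTorusKernels}`; p20's `B3Ineq210MixedTorus.{mixedT, ineq210_mixed_zeroTorus_rpow}` and
`B3Sect3KernelsZeroTorus.{gpiece, pieceT_symm, d1Kernel_gpiece, dAdjKernel_gpiece, d2Kernel_gpiece, dKernel_gpiece}`; r14's
`B3Ineq210RegularTorus.{pieceA, sum_pieceA}`; p33's `B3Ineq210RegularZeroBridge.{cmpAt_pieceA, ineq210_zeroTorus_massWindow}`; r15's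
`B3Sect3ScalarSelfEnergy.{d1Kernel, dKernel}`, `B3Sect3VectorSelfEnergy.{dAdjKernel, d2Kernel}`; p14's `B1Eq211ZeroFieldTorus.Shape`,
`B1Eq211ZeroFieldTorusLevels.{setupAt, eSiteAt, eSiteAt_shift, mesh_zero_eq_at, le_range_at, cmpAt, cmpAt_apply, cmpAt_apply_eSiteAt}`,
`B1Eq220ZeroFieldTorusLevels.{propagatorK_zero_apply_at, T_eSiteAt}`; the typer's `HiggsLattice.{Params, Site, Site.tdist, Site.shift,
ScalarField, VecField, ChargeData, Params.mesh}`, `HiggsCovariance.propagatorK`; FILE 2's `B3GraphAmplitudeRules.{basisE, basisE_apply,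
opEntry}`; FILE 5's `B3Eq39FromFeynmanRules.dKernelT`; FILE 6's `B3Eq326FromFeynmanRules.{dKernelL, dKernelR, d2KernelT}`;
`B1RG242Torus.{tower, deriv}`, `B5Ineq137Torus.T`, `Setup`'s `Params`, `Site`, `Params.eps`, `Params.spacing`.

WHAT IS PRINTED (verbatim).  p. 412 [PDF 2], (1.1): *"A = A′ + A^{(k)} = A′^{(0),η} + … + A′^{(k−1),η} + A^{(k)}, η = L^{−k}, (1.1)"*
(render `run/shared/lean/pub/pub-balaban/b2b-balaban-ref1/pages/1983-cmp88-higgs23-III/1983-cmp88-higgs23-III-p002-x2.png` read as an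
image by this seat; (1.4) ibid. carries the mass as `m²(L^kε)²` — the rescaled frame).  p. 424 [PDF 14]: *"… decomposing all the
propagators corresponding to the lines of G′ according to the equality G_k(Ω,B̃) = Σ_{j=0}^{k−1} G^η_{(j)}(Ω,B̃) (2.6)"*.  p. 426 [PDF 16]: *"For the propagators
G^η_{(j)} we apply the inequality |G^η_{(j)}(Ω, B̃; x, x′)| ≤ O(1)(L^jη)^{−d+2}e^{−δ₁(L^jη)^{−1}|x−x′|}, (2.10) and if the propagator is
differentiated, then for each differentiation, there is an additional factor (L^jη)^{−1} on the right side. … They all are obtained by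
rescaling from the η-lattice to the L^{−j}-lattice and application of Propositions I.2.1 and I.2.3."*  [Balaban1982Higgs1] p. 604
[PDF 2], (1.3): *"|x − y| = max_μ min{|x_μ − y_μ|, 2L_μ − |x_μ − y_μ|}"*.

READING (declared).  (a) CARRIERS: `P : HiggsLattice.Params` is the model's torus `T_ε` (typer), `S : Shape P` a torus of the sub-family
`M·L′_μ = L^m`, `L` odd (the family on which the tree's two torus carriers are identified at all); `setupAt S k` is p14's level-`k`
`Setup` torus: the SAME sites (`eSiteAt S hk : HiggsLattice.Site P 0 ≃ Site (setupAt S k) 0`), spacing `(setupAt S k).eps = L^{−k} = η`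
of (1.1) and `(setupAt S k).spacing j = L^jη` — print's rescaled frame of Chap. 2; the model's own mesh is `P.mesh 0 = ε = (L^kε)·η`
(`mesh_zero_eq_at`).  (b) PIECES: `pieceH S hk a m′² j (x, x′) := pieceT (setupAt S k) a m′² k j (e x, e x′)` — the MATRIX of print's
`G^η_{(j)}(T_η, 0)` (the `j`-th term of (2.6) for the zero-field torus tower at scale `k`, tower mass parameter `m′²`), and
`gpieceH := η^{−d}·pieceH` (p20's `gpiece` read on the Higgs carrier) — its KERNEL w.r.t. the `η^d`-weighted sums of (1.5)/(3.9), the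
object (2.10) bounds (p03's normalisation `absG = η^{−d}|piece|`).  (c) AT THE MODEL'S PROPAGATOR: by p14's (2.20)↔(2.22)
dictionary the matrix entries of `G^ε_k(T_ε, 0)` on the basis fields `δ_x ⊗ e_i` (FILE 2's `opEntry`) are `[i = i′]·(L^kε)²·Σ_{j<k}
pieceH_j(x,x′)` with tower mass `m²(L^kε)²` (`opEntry_propagatorK_zero_pieces`) — the scalar line kernel of the evaluator at zero
background DECOMPOSED INTO SCALE PIECES ((2.6)); which multiple of `pieceH_j ⊗ 1_N` a consumer puts on a line of scale index `j`
(`(L^kε)²·pieceH_j`, or `gpieceH_j` in print's frame `L^kε = 1`, `ε = η`) is the consumer's normalisation, recorded here, not chosen.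
(c′) THE PIECES OF RECORD: r14's covariant scale pieces `pieceA C A m² a k j` (`B3Ineq210RegularTorus`; their sum is `G^ε_k(T_ε, A)`,
`sum_pieceA` — the tree's (2.6) of record on this carrier) have at `A = 0` the matrix entries `[i = i′]·(L^kε)²·pieceH_j(x,x′)`
(`opEntry_pieceA_zero`, from p33's `cmpAt_pieceA`): a scalar line of scale index `j` at print's zero-background data carries the free
symmetric kernel `(L^kε)²·pieceH_j ⊗ 1_N` — exactly the hypothesis shape `Ks l p p′ = [p.2 = p′.2]·C₀(p.1,p′.1)`, `C₀` symmetric, of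
the `_print` theorems of FILEs 11/13 (`graphAmp_g318b_print`, …, `graphAmp_g122g_print`).
(d) DISTANCE, named explicitly (r15's header ask): the bounds are stated in the printed torus distance [Balaban1982Higgs1] (1.3)
p. 604 *"|x − y| = max_μ min{|x_μ − y_μ|, 2L_μ − |x_μ − y_μ|}"* in lattice units, i.e. the typer's `HiggsLattice.Site.tdist` — the SUP
(ℓ^∞) torus distance, `=` the tower lineage's `B5Ineq137Torus.T` under `e` (p14's `T_eSiteAt`) — times `η`: `η·tdist x x′ = |x − x′|` of
(2.10).  It is NOT the ℓ¹ torus distance `Setup.Site.tdist` in which p20's `B3Sect3KernelsZeroTorus.gpiece_bounds` and the Sect. 3 files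
state their kernel inputs (`ℓ^∞ ≤ ℓ¹ ≤ d·ℓ^∞`; a consumer wanting the ℓ¹ form divides the rate by `d`, as p20 does).
(e) BACKGROUND, named explicitly (r15's header ask): `B̃ = 0` (`U ≡ 1`) and `Ω = T_η` the whole torus — the zero-field torus model
instance of p03/p20; print's (2.10) is stated for `G^η_{(j)}(Ω, B̃)` at a regular background `B̃` and regions `Ω` — those instances are
r14's `B3Ineq210RegularTorus` ∕ `B3Ineq211RegularTorus`, the box/region members `B3Ineq210ZeroBox`, `B3Ineq210RegularBox`,
`B3Ineq210RegularRegion`, `B3Ineq210MixedRegularTorus` (by name; not used here).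

WHAT IS TYPED / PROVED (4 `def`s with bodies — `pieceH`, `gpieceH`, `witnessParams`, `witnessShape`; theorems; no `Prop` fact, no
`sorry`; standard axioms).
§1 `pieceH`, `gpieceH`, `gpieceH_eq` (`= η^{−d}·pieceH`), `pieceH_symm` ∕ `gpieceH_symm` (p20's `pieceT_symm`); the evaluator's
difference quotients of the pulled-back kernel ARE r15's ∕ p03's ∕ p20's quantities on the `Setup` carrier (`eSiteAt_shift`):
`dKernelL_gpieceH` (= r15's `d1Kernel`, = `η^{−d}(∂^η_μ·pieceT)` — p03's `absDG` object: `dKernelL_gpieceH_eq_deriv`), `dKernelR_gpieceH`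
(= `dAdjKernel`; by symmetry the row difference at swapped arguments: `dKernelR_gpieceH_eq_deriv`), `d2KernelT_gpieceH` (= `d2Kernel` =
`η^{−d}·mixedT`: `d2KernelT_gpieceH_eq_mixedT`), `dKernelT_gpieceH` ∕ `dKernelT_gpieceH_eq_d2KernelT` (FILE 5's diagonal second difference).
§2 **(2.6) on the Higgs carrier**: `sum_pieceH` (`Σ_{j<k} pieceH_j(x,x′) = G_k(e x, e x′)` of the tower, p03's `sum_pieceT`),
`opEntry_propagatorK_zero` ∕ `opEntry_propagatorK_zero_pieces` (reading (c)), **`opEntry_pieceA_zero`** (reading (c′)) and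
`sum_opEntry_pieceA` ((2.6) of record entrywise, every background).
§3 **(2.10) for the pulled-back pieces**: **`gpieceH_bounds_massWindow`** — for `d ≥ 1`, odd `L > 1`, `a > 0`, `m₊² ≥ 0` there are
`δ₁, C > 0` (functions of `d, L, a, m₊²`) such that for EVERY `P`, `S` with these `d, L`, every tower mass `m′² ∈ [0, m₊²]`, every
`1 ≤ k ≤ K`, all `j`, directions and sites: `|gpieceH_j(x,x′)| ≤ C(L^jη)^{2−d}e^{−δ₁(L^jη)^{−1}η·tdist(x,x′)}` (value),
`|dKernelL η⁻¹ μ gpieceH_j (x,x′)|`, `|dKernelR η⁻¹ μ gpieceH_j (y,x′)| ≤ C(L^jη)^{1−d}e^{…}` (one differentiation, either end; p33's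
mass-window assembly of p03's theorem + symmetry); **`gpieceH_mixed_bound`** — `|d2KernelT η⁻¹ μ μ′ gpieceH_j (x,x′)| ≤ C(L^jη)^{−d}e^{…}`
(one differentiation at each end; p20, one mass); **`gpieceH_bounds_model`** — the window specialised to the model's step-`k` tower mass
`m²(L^kε)²` (`L^kε ≤ 1`): constants uniform in `k`.  These are EXACTLY the right-hand objects of FILE 15's `abs_dK1_zero_free_le` ∕
`abs_dK2_zero_free_le` ∕ `abs_dKs_zero_free_le` (FILE 14's signed line hypotheses at zero background) and, through `abs_freeKernel_le`,
the entry bound FILE 12 §5b's `sum2_attSK_le_of_entry_bound` consumes; stated WITHOUT importing FILE 12 ∕ 14 ∕ 15.  §4 UNITS for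
consumers working with the model's mesh: `inv_mesh_zero`, `dKernelL_mesh0` ∕ `dKernelR_mesh0` ∕ `d2KernelT_mesh0`
(`dKernelL (P.mesh 0)⁻¹ = (L^kε)⁻¹·dKernelL η⁻¹`, …).  §5 non-vacuity (`gpieceH_bounds_witness`).  §6 (v1.1) THE VECTOR-FIELD LINE
KERNEL at zero background — the tree's `HiggsFluctMeasure.vecG` = `propagatorK` with `N = d` and the zero charge ([Balaban1982Higgs1] p. 608
*"taking N = d and an external vector field A = 0"*): `towerG_eSiteAt_symm`, **`bondEntry_vecG_zero`** (FILE 2's `bondEntry (G_k) b b′ =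
[μ(b) = μ(b′)]·(L^kε)²·G_k(e b₋, e b′₋)` — the `hKv` shape `[b.dir = b′.dir]·C(b.src, b′.src)`, `C` symmetric, of FILEs 11/13),
`bondEntry_vecG_zero_pieces`, `bondEntry_pieceA_zero`, `sum_bondEntry_pieceA` (all corollaries of §2 at `C := zeroCharge d`).
§7 (v1.2) THE BOTH-ENDS CLAUSE OVER A MASS WINDOW: **`ineq210_mixed_zeroTorus_massWindow`** (p20's one-volume lemma
`abs_mixedPieceT_le_of` re-assembled over `m′² ∈ [0, m₊²]` with `kerBounds_torus` + `G0unit_decay_cap`, exactly as p33 re-assembled p03's),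
`gpieceH_mixed_bound_massWindow`, **`gpieceH_mixed_bound_model`** — so all three differentiation patterns of (2.10) hold at the model's
step-`k` data with constants uniform in `k` (HONEST SCOPE (i)'s one-mass caveat for the both-ends clause is thereby lifted).
§8 (v1.3) THROUGH THE TORUS ∕ BOX SEAM (FILE 17 `B3Eq213TorusBoxSeam`, imported): **`gpieceH_lineBounds_halfTorus`** — `gpieceH_bounds_model`
composed with FILE 17's `lineBound_labelChart_of_torusBound_setupAt`: the value and the two one-differentiation clauses of (2.10) at zero
background READ THROUGH THE LABEL CHART of `T_η` on the points of two blocks in the half-torus, i.e. LITERALLY the body of p19's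
`B3Ineq213Amplitude.Amp.K_le` ∕ FILE 12 §8's hypothesis `K_le` (`δ₀ = δ₁∕2`, `a_l = 2 − d` resp. `1 − d`, `L^tη = L^t(L^k)^{−1}`, box distance
`supDist`), constants uniform in `k` — HONEST SCOPE (iii)'s seam is thereby closed for half-torus blocks (FILE 17's based chart `labelChartAt`
serves any base point; the instance here is the chart about the origin).
HONEST SCOPE.  (i) Scope of the PROVED instance: `A = B̃ = 0` (`U ≡ 1`), `Ω = T_η` the whole torus, the sub-family of tori above, fixed
`a > 0`; constants existential, functions of `d, L, a` and the mass window `m₊²` (value ∕ one differentiation) or the tower mass `m′²`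
(one differentiation at each end — p20's theorem is assembled at one mass); nothing at `B̃ ≠ 0` or for regions `Ω ⊊ T_η` (reading
(e)).  (ii) Only the undifferentiated, once- and (once at each end)-differentiated kernels — what p03/p20 prove and what
`ScaledKernels.Ineq210` types; (2.11) (Hölder differences) and (2.12) (averaged vector legs) are not touched.  (iii) The seam between
the torus distance used here (print's (1.3)) and the box coordinates `supDist` of p19's `Amp.K_le` (`B3Ineq213Points`, positions in
`ηℤ^d_{≥0}`) stays the consumer's, as FILE 12's header records (a torus bound transfers to chart coordinates only where no wrap-around
occurs).  (iv) Pure transport + bookkeeping over the cited tree theorems; nothing of p03/p14/p20/p33/r14 is re-proved.  Unit `lit-balaban-p26`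
gen 45 (literature-prover-lit-balaban-p26-g45-0), HOME `run/shared/lean/pub/lit-balaban/`, 2026-08-24; v1.1 (§6 appended, code-level append-only) and v1.2 (§7 appended, code-level append-only) same day; v1.3 (§8 appended,
code-level append-only, + one import) same day.
-/

open Finset
open scoped BigOperators Matrix

namespace Literature.MathematicalPhysics.QuantumFieldTheory.Balaban1983to89.B3Ineq210ZeroHiggsTorus

open Literature.MathematicalPhysics.QuantumFieldTheory.Balaban1983to89.HiggsLattice (ChargeData)
open Literature.MathematicalPhysics.QuantumFieldTheory.Balaban1983to89.HiggsCovariance (propagatorK)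
open Literature.MathematicalPhysics.QuantumFieldTheory.Balaban1983to89.B1Eq211ZeroFieldTorus (Shape)
open Literature.MathematicalPhysics.QuantumFieldTheory.Balaban1983to89.B1Eq211ZeroFieldTorusLevels (setupAt eSiteAt eSiteAt_shift
  mesh_zero_eq_at le_range_at cmpAt cmpAt_apply cmpAt_apply_eSiteAt)
open Literature.MathematicalPhysics.QuantumFieldTheory.Balaban1983to89.B1Eq220ZeroFieldTorusLevels (propagatorK_zero_apply_at
  T_eSiteAt)
open Literature.MathematicalPhysics.QuantumFieldTheory.Balaban1983to89.B3GraphAmplitudeRules (basisE basisE_apply opEntry)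
open Literature.MathematicalPhysics.QuantumFieldTheory.Balaban1983to89.B3Eq39FromFeynmanRules (dKernelT)
open Literature.MathematicalPhysics.QuantumFieldTheory.Balaban1983to89.B3Eq326FromFeynmanRules (dKernelL dKernelR d2KernelT)
open B1RG242Torus (tower deriv)
open B5Ineq137Torus (T)
open B3Ineq210ZeroTorus (pieceT sum_pieceT zeroTorusKernels)
open B3Ineq210MixedTorus (mixedT ineq210_mixed_zeroTorus_rpow)
open B3Sect3KernelsZeroTorus (gpiece pieceT_symm d1Kernel_gpiece dAdjKernel_gpiece d2Kernel_gpiece dKernel_gpiece)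
open B3Sect3ScalarSelfEnergy (d1Kernel dKernel)
open B3Sect3VectorSelfEnergy (dAdjKernel d2Kernel)
open B3Ineq210RegularTorus (pieceA sum_pieceA)
open B3Ineq210RegularZeroBridge (cmpAt_pieceA ineq210_zeroTorus_massWindow)

noncomputable section

section Pullback

variable {P : HiggsLattice.Params} {N : ℕ} (S : Shape P) {k : ℕ} (hk : k ≤ P.K)

/-! ## §1 The scale pieces of (2.6) pulled back to the (Higgs)₂,₃ carrier; the evaluator's difference quotients on them -/

/-- **The matrix of the scale piece `G^η_{(j)}(T_η, 0)` of (2.6), read on the (Higgs)₂,₃ carrier**: p03's `pieceT` of the zero-field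
torus tower at scale `k` (level-`k` `Setup` torus of the shape `S`, `η = L^{−k}`, tower mass parameter `m′²`) at the identified sites.
[cite: Balaban1983Higgs3, (2.6) p.424] -/
def pieceH (a msq : ℝ) (j : ℕ) (x x' : HiggsLattice.Site P 0) : ℝ :=
  pieceT (setupAt S k) a msq k j (eSiteAt S hk (Nat.zero_le k) x) (eSiteAt S hk (Nat.zero_le k) x')

/-- **The KERNEL `G^η_{(j)}(T_η, 0; x, x′)` of (2.6)/(2.10) on the (Higgs)₂,₃ carrier** (w.r.t. the `η^d`-weighted sums): p20's
`gpiece = η^{−d}·pieceT` at the identified sites — the object (2.10) bounds. [cite: Balaban1983Higgs3, (2.10) p.426] -/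
def gpieceH (a msq : ℝ) (j : ℕ) (x x' : HiggsLattice.Site P 0) : ℝ :=
  gpiece (setupAt S k) a msq k j (eSiteAt S hk (Nat.zero_le k) x) (eSiteAt S hk (Nat.zero_le k) x')

/-- `gpieceH = η^{−d}·pieceH`, `η = L^{−k}` the spacing of the level-`k` `Setup` torus. [cite: Balaban1983Higgs3, (2.10) p.426] -/
theorem gpieceH_eq (a msq : ℝ) (j : ℕ) (x x' : HiggsLattice.Site P 0) :
    gpieceH S hk a msq j x x' = ((setupAt S k).eps ^ P.d)⁻¹ * pieceH S hk a msq j x x' := rfl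

/-- **The pieces are symmetric**: `G_{(j)}(x, x′) = G_{(j)}(x′, x)` (p20's `pieceT_symm`; `a > 0`, `m′² ≥ 0`).
[cite: Balaban1983Higgs3, (2.6) p.424] -/
theorem pieceH_symm {a msq : ℝ} (ha : 0 < a) (hm : 0 ≤ msq) (j : ℕ) (x x' : HiggsLattice.Site P 0) :
    pieceH S hk a msq j x x' = pieceH S hk a msq j x' x :=
  pieceT_symm (P := setupAt S k) ha hm (le_range_at S k le_rfl) j _ _

/-- The kernels are symmetric. [cite: Balaban1983Higgs3, (2.6) p.424] -/
theorem gpieceH_symm {a msq : ℝ} (ha : 0 < a) (hm : 0 ≤ msq) (j : ℕ) (x x' : HiggsLattice.Site P 0) :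
    gpieceH S hk a msq j x x' = gpieceH S hk a msq j x' x := by
  rw [gpieceH_eq, gpieceH_eq, pieceH_symm S hk ha hm]

/-- **FILE 6's `(∂^η_μ G)(x, x′)` of the pulled-back kernel IS r15's `d1Kernel` of p20's `gpiece` at the identified sites** (the
identification commutes with the unit steps, p14's `eSiteAt_shift`). [cite: Balaban1983Higgs3, (2.10) p.426] -/
theorem dKernelL_gpieceH (c : ℝ) (μ : Fin P.d) (a msq : ℝ) (j : ℕ) (x x' : HiggsLattice.Site P 0) :
    dKernelL c μ (gpieceH S hk a msq j) x x' =
      d1Kernel c μ (gpiece (setupAt S k) a msq k j) (eSiteAt S hk (Nat.zero_le k) x) (eSiteAt S hk (Nat.zero_le k) x') := by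
  simp only [dKernelL, d1Kernel, gpieceH, eSiteAt_shift]

/-- **FILE 6's `(G ∂^{η*}_μ)(y, x′)` of the pulled-back kernel IS r15's `dAdjKernel`** at the identified sites.
[cite: Balaban1983Higgs3, (2.10) p.426] -/
theorem dKernelR_gpieceH (c : ℝ) (μ : Fin P.d) (a msq : ℝ) (j : ℕ) (y x' : HiggsLattice.Site P 0) :
    dKernelR c μ (gpieceH S hk a msq j) y x' =
      dAdjKernel c μ (gpiece (setupAt S k) a msq k j) (eSiteAt S hk (Nat.zero_le k) y) (eSiteAt S hk (Nat.zero_le k) x') := by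
  simp only [dKernelR, dAdjKernel, gpieceH, eSiteAt_shift]

/-- **FILE 6's `(∂^η_μ G ∂^{η*}_{μ′})(x, x′)` of the pulled-back kernel IS r15's `d2Kernel`** at the identified sites.
[cite: Balaban1983Higgs3, (2.10) p.426] -/
theorem d2KernelT_gpieceH (c : ℝ) (μ μ' : Fin P.d) (a msq : ℝ) (j : ℕ) (x x' : HiggsLattice.Site P 0) :
    d2KernelT c μ μ' (gpieceH S hk a msq j) x x' =
      d2Kernel c μ μ' (gpiece (setupAt S k) a msq k j) (eSiteAt S hk (Nat.zero_le k) x) (eSiteAt S hk (Nat.zero_le k) x') := by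
  simp only [d2KernelT, d2Kernel, gpieceH, eSiteAt_shift]

/-- FILE 5's diagonal second difference `(∂^η_μ G ∂^{η*}_μ)(x, x′)` ((3.9)) of the pulled-back kernel IS r15's `dKernel` at the identified
sites. [cite: Balaban1983Higgs3, (3.9) p.435] -/
theorem dKernelT_gpieceH (c : ℝ) (μ : Fin P.d) (a msq : ℝ) (j : ℕ) (x x' : HiggsLattice.Site P 0) :
    dKernelT c μ (gpieceH S hk a msq j) x x' =
      dKernel c μ (gpiece (setupAt S k) a msq k j) (eSiteAt S hk (Nat.zero_le k) x) (eSiteAt S hk (Nat.zero_le k) x') := by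
  simp only [dKernelT, dKernel, gpieceH, eSiteAt_shift]

/-- FILE 5's `dKernelT` is the diagonal `μ′ = μ` of FILE 6's `d2KernelT` (FILE 6's `d2KernelT_diag`). [cite: Balaban1983Higgs3, (3.9) p.435] -/
theorem dKernelT_gpieceH_eq_d2KernelT (c : ℝ) (μ : Fin P.d) (a msq : ℝ) (j : ℕ) (x x' : HiggsLattice.Site P 0) :
    dKernelT c μ (gpieceH S hk a msq j) x x' = d2KernelT c μ μ (gpieceH S hk a msq j) x x' := rfl

/-- The once-differentiated kernel in p03's matrix form: `(∂^η_μ G_{(j)})(x,x′) = η^{−d}·(∂^η_μ·pieceT_j)(e x, e x′)` — p03's `absDG`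
object of `zeroTorusKernels` (`η = L^{−k}`). [cite: Balaban1983Higgs3, (2.10) p.426] -/
theorem dKernelL_gpieceH_eq_deriv (μ : Fin P.d) (a msq : ℝ) (j : ℕ) (x x' : HiggsLattice.Site P 0) :
    dKernelL ((setupAt S k).eps)⁻¹ μ (gpieceH S hk a msq j) x x' =
      ((setupAt S k).eps ^ P.d)⁻¹ *
        (deriv (setupAt S k) 0 (setupAt S k).eps μ * pieceT (setupAt S k) a msq k j) (eSiteAt S hk (Nat.zero_le k) x)
          (eSiteAt S hk (Nat.zero_le k) x') := by
  rw [dKernelL_gpieceH, d1Kernel_gpiece]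
  rfl

/-- The kernel differentiated at its second endpoint, in p03's matrix form BY SYMMETRY: `(G_{(j)}∂^{η*}_μ)(y,x′) =
η^{−d}·(∂^η_μ·pieceT_j)(e x′, e y)` (`a > 0`, `m′² ≥ 0`). [cite: Balaban1983Higgs3, (2.10) p.426] -/
theorem dKernelR_gpieceH_eq_deriv {a msq : ℝ} (ha : 0 < a) (hm : 0 ≤ msq) (μ : Fin P.d) (j : ℕ) (y x' : HiggsLattice.Site P 0) :
    dKernelR ((setupAt S k).eps)⁻¹ μ (gpieceH S hk a msq j) y x' =
      ((setupAt S k).eps ^ P.d)⁻¹ *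
        (deriv (setupAt S k) 0 (setupAt S k).eps μ * pieceT (setupAt S k) a msq k j) (eSiteAt S hk (Nat.zero_le k) x')
          (eSiteAt S hk (Nat.zero_le k) y) := by
  rw [dKernelR_gpieceH, dAdjKernel_gpiece ha hm (le_range_at S k le_rfl)]
  rfl

/-- The kernel differentiated once at each end, in p20's matrix form:
`(∂^η_μ G_{(j)} ∂^{η*}_{μ′})(x,x′) = η^{−d}·mixedT_{μμ′}(pieceT_j)(e x, e x′)`.
[cite: Balaban1983Higgs3, (2.10) p.426] -/
theorem d2KernelT_gpieceH_eq_mixedT (μ μ' : Fin P.d) (a msq : ℝ) (j : ℕ) (x x' : HiggsLattice.Site P 0) :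
    d2KernelT ((setupAt S k).eps)⁻¹ μ μ' (gpieceH S hk a msq j) x x' =
      ((setupAt S k).eps ^ P.d)⁻¹ *
        mixedT (setupAt S k) (setupAt S k).eps μ μ' (pieceT (setupAt S k) a msq k j) (eSiteAt S hk (Nat.zero_le k) x)
          (eSiteAt S hk (Nat.zero_le k) x') := by
  rw [d2KernelT_gpieceH, d2Kernel_gpiece]
  rfl

/-! ## §2 (2.6) on the (Higgs)₂,₃ carrier: the pulled-back pieces ARE the pieces of record (r14's `pieceA`) at zero field -/

/-- **(2.6) on the (Higgs)₂,₃ carrier**: `Σ_{j=0}^{k−1} pieceH_j(x, x′) = G_k(e x, e x′)` — the top propagator of the zero-field torus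
tower at scale `k` (p03's `sum_pieceT` = [Balaban1982Higgs1] (2.42)/(2.43) on the torus), `1 ≤ k`, `a > 0`, `m′² ≥ 0`.
[cite: Balaban1983Higgs3, (2.6) p.424] -/
theorem sum_pieceH {a msq : ℝ} (ha : 0 < a) (hm : 0 ≤ msq) (hk1 : 1 ≤ k) (x x' : HiggsLattice.Site P 0) :
    ∑ j ∈ Finset.range k, pieceH S hk a msq j x x' =
      (tower (setupAt S k) a msq).G k (eSiteAt S hk (Nat.zero_le k) x) (eSiteAt S hk (Nat.zero_le k) x') := by
  rw [← sum_pieceT (P := setupAt S k) ha hm hk1, Matrix.sum_apply]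
  rfl

/-- kernel: a matrix of the level-`k` torus applied to the `i`-th colour of FILE 2's basis field `δ_{x′} ⊗ e_{i′}` (read through p14's
`cmpAt`), evaluated at `e x`, is `[i = i′]·M(e x, e x′)`. [folklore] -/
private theorem mulVec_cmpAt_basisE (M : Matrix (Site (setupAt S k) 0) (Site (setupAt S k) 0) ℝ) (i : Fin N)
    (p' : HiggsLattice.Site P 0 × Fin N) (x : HiggsLattice.Site P 0) :
    (M *ᵥ cmpAt S hk i (basisE p')) (eSiteAt S hk (Nat.zero_le k) x) =
      if i = p'.2 then M (eSiteAt S hk (Nat.zero_le k) x) (eSiteAt S hk (Nat.zero_le k) p'.1) else 0 := by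
  simp only [Matrix.mulVec, dotProduct, cmpAt_apply, basisE_apply]
  rw [← Equiv.sum_comp (eSiteAt S hk (Nat.zero_le k))]
  simp only [Equiv.symm_apply_apply]
  by_cases hc : i = p'.2
  · rw [if_pos hc, Finset.sum_eq_single p'.1]
    · simp [hc]
    · intro y _ hy
      simp [hy]
    · intro h
      exact absurd (Finset.mem_univ _) h
  · rw [if_neg hc]
    simp [hc]

/-- **The matrix entries of the model's propagator `G^ε_k(T_ε, 0)` (I.2.20) at zero field on FILE 2's basis fields `δ_x ⊗ e_i`**:
`opEntry (G^ε_k(T_ε,0)) ((x,i),(x′,i′)) = [i = i′]·(L^kε)²·G_k(e x, e x′)`, `G_k` the top propagator of the level-`k` torus tower at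
mass `m²(L^kε)²` (p14's `propagatorK_zero_apply_at`: (2.20) = `(L^kε)²·`(2.22)); every coupling `C`, `1 ≦ k ≦ K`, `a > 0`, `m² ≧ 0`.
[cite: Balaban1982Higgs1, (2.20) p.610] [cite: Balaban1983Higgs3, (2.6) p.424] -/
theorem opEntry_propagatorK_zero (C : ChargeData N) {a msq : ℝ} (hk1 : 1 ≤ k) (ha : 0 < a) (hmsq : 0 ≤ msq)
    (p p' : HiggsLattice.Site P 0 × Fin N) :
    opEntry (propagatorK C Finset.univ (0 : HiggsLattice.VecField P 0) msq a k) p p' =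
      if p.2 = p'.2 then
        P.mesh k ^ 2 * (tower (setupAt S k) a (msq * P.mesh k ^ 2)).G k (eSiteAt S hk (Nat.zero_le k) p.1)
          (eSiteAt S hk (Nat.zero_le k) p'.1)
      else 0 := by
  unfold opEntry
  rw [propagatorK_zero_apply_at S hk C hk1 ha hmsq (basisE p') p.1 p.2, mulVec_cmpAt_basisE]
  simp only [mul_ite, mul_zero]

/-- **The scalar line kernel of the evaluator at zero background DECOMPOSED INTO SCALE PIECES ((2.6))**: the matrix entries of
`G^ε_k(T_ε, 0)` on the basis fields are `[i = i′]·(L^kε)²·Σ_{j<k} pieceH_j(x, x′)` with tower mass `m²(L^kε)²`.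
[cite: Balaban1983Higgs3, (2.6) p.424] [cite: Balaban1982Higgs1, (2.20) p.610] -/
theorem opEntry_propagatorK_zero_pieces (C : ChargeData N) {a msq : ℝ} (hk1 : 1 ≤ k) (ha : 0 < a) (hmsq : 0 ≤ msq)
    (p p' : HiggsLattice.Site P 0 × Fin N) :
    opEntry (propagatorK C Finset.univ (0 : HiggsLattice.VecField P 0) msq a k) p p' =
      if p.2 = p'.2 then P.mesh k ^ 2 * ∑ j ∈ Finset.range k, pieceH S hk a (msq * P.mesh k ^ 2) j p.1 p'.1 else 0 := by
  rw [opEntry_propagatorK_zero S hk C hk1 ha hmsq, sum_pieceH S hk ha (mul_nonneg hmsq (sq_nonneg _)) hk1]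

/-- **THE PIECES OF RECORD AT ZERO FIELD ARE `(L^kε)²·pieceH_j ⊗ 1_N`**: r14's covariant scale pieces `pieceA C 0 m² a k j` of
`B3Ineq210RegularTorus` (the (I.2.43) terms of the model's propagator — the tree's (2.6) of record, `Σ_{j<k} pieceA_j = G^ε_k(T_ε, A)` =
`B3Ineq210RegularTorus.sum_pieceA`) have, at `A = 0` and for every coupling, the matrix entries `[i = i′]·(L^kε)²·pieceH_j(x, x′)` on
FILE 2's basis fields (tower mass `m²(L^kε)²`; p33's `B3Ineq210RegularZeroBridge.cmpAt_pieceA` read on `δ_{x′} ⊗ e_{i′}`).  So a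
scalar line of scale index `j` of the evaluator at print's zero-background data carries the free kernel `(L^kε)²·pieceH_j ⊗ 1_N` — the
shape `Ks l p p′ = [p.2 = p′.2]·C₀(p.1, p′.1)`, `C₀` symmetric, that the `_print` theorems of FILEs 11/13 take as hypothesis.
[cite: Balaban1983Higgs3, (2.6) p.424] -/
theorem opEntry_pieceA_zero (C : ChargeData N) {a msq : ℝ} (hk1 : 1 ≤ k) (ha : 0 < a) (hmsq : 0 ≤ msq) (j : ℕ)
    (p p' : HiggsLattice.Site P 0 × Fin N) :
    opEntry (pieceA C (0 : HiggsLattice.VecField P 0) msq a k j) p p' =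
      if p.2 = p'.2 then P.mesh k ^ 2 * pieceH S hk a (msq * P.mesh k ^ 2) j p.1 p'.1 else 0 := by
  have h := congrFun (cmpAt_pieceA S hk C hk1 ha hmsq j (basisE p') p.2) (eSiteAt S hk (Nat.zero_le k) p.1)
  rw [cmpAt_apply_eSiteAt, Pi.smul_apply, smul_eq_mul, mulVec_cmpAt_basisE] at h
  unfold opEntry pieceH
  rw [h]
  simp only [mul_ite, mul_zero]

include hk in
/-- **(2.6) of record, entrywise, at every background**: `Σ_{j<k} opEntry (G^η_{(j)}(T_ε, A)) = opEntry (G^ε_k(T_ε, A))` on FILE 2's basis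
fields (r14's `sum_pieceA`; `1 ≦ k ≦ K`, `L > 1`, `a > 0`, `m² ≧ 0`). [cite: Balaban1983Higgs3, (2.6) p.424] -/
theorem sum_opEntry_pieceA (C : ChargeData N) (A : HiggsLattice.VecField P 0) {a msq : ℝ} (hm : 0 ≤ msq) (ha : 0 < a)
    (hL1 : 1 < P.L) (hk1 : 1 ≤ k) (p p' : HiggsLattice.Site P 0 × Fin N) :
    ∑ j ∈ Finset.range k, opEntry (pieceA C A msq a k j) p p' = opEntry (propagatorK C Finset.univ A msq a k) p p' := by
  rw [← sum_pieceA hm ha hL1 hk1 hk]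
  unfold opEntry
  rw [LinearMap.sum_apply, Finset.sum_apply, WithLp.ofLp_sum, Finset.sum_apply]

/-! ## §4 Units: the model's mesh `ε = (L^kε)·η` versus print's `η = L^{−k}` in the difference quotients -/

/-- `ε⁻¹ = (L^kε)⁻¹·η⁻¹` (p14's `mesh_zero_eq_at`). [cite: Balaban1983Higgs3, (1.1) p.412] -/
theorem inv_mesh_zero : (P.mesh 0)⁻¹ = (P.mesh k)⁻¹ * ((setupAt S k).eps)⁻¹ := by
  rw [mesh_zero_eq_at S k, mul_inv]

/-- `dKernelL` with the model's constant `ε⁻¹` (FILE 15's `abs_dK1_zero_free_le`) is `(L^kε)⁻¹` times `dKernelL` with print's `η⁻¹`.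
[cite: Balaban1983Higgs3, (1.1) p.412] -/
theorem dKernelL_mesh0 (μ : Fin P.d) (G : HiggsLattice.Site P 0 → HiggsLattice.Site P 0 → ℝ) (x y : HiggsLattice.Site P 0) :
    dKernelL (P.mesh 0)⁻¹ μ G x y = (P.mesh k)⁻¹ * dKernelL ((setupAt S k).eps)⁻¹ μ G x y := by
  simp only [dKernelL, inv_mesh_zero S (k := k)]
  ring

/-- `dKernelR` likewise. [cite: Balaban1983Higgs3, (1.1) p.412] -/
theorem dKernelR_mesh0 (μ : Fin P.d) (G : HiggsLattice.Site P 0 → HiggsLattice.Site P 0 → ℝ) (y x : HiggsLattice.Site P 0) :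
    dKernelR (P.mesh 0)⁻¹ μ G y x = (P.mesh k)⁻¹ * dKernelR ((setupAt S k).eps)⁻¹ μ G y x := by
  simp only [dKernelR, inv_mesh_zero S (k := k)]
  ring

/-- `d2KernelT` carries the square: `(L^kε)⁻²`. [cite: Balaban1983Higgs3, (1.1) p.412] -/
theorem d2KernelT_mesh0 (μ μ' : Fin P.d) (G : HiggsLattice.Site P 0 → HiggsLattice.Site P 0 → ℝ) (x x' : HiggsLattice.Site P 0) :
    d2KernelT (P.mesh 0)⁻¹ μ μ' G x x' = ((P.mesh k)⁻¹) ^ 2 * d2KernelT ((setupAt S k).eps)⁻¹ μ μ' G x x' := by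
  simp only [d2KernelT, inv_mesh_zero S (k := k)]
  ring

end Pullback

/-! ## §3 (2.10) for the pulled-back pieces: hypothesis-free, uniform in the volume, the scale and the mass window, in the printed
distance (1.3) -/

section Bounds

/-- kernel: the torus distance (1.3) is symmetric. [folklore] -/
private theorem tdist_comm {P : HiggsLattice.Params} {j : ℕ} (x y : HiggsLattice.Site P j) :
    HiggsLattice.Site.tdist x y = HiggsLattice.Site.tdist y x := by
  unfold HiggsLattice.Site.tdist
  congr 1
  funext μ
  exact min_comm _ _

/-- The free kernel `G ⊗ 1_N` on `T_η × {1..N}` (FILEs 5–7, 11, 13: `K (x,a) (x′,a′) = [a = a′]·G(x,x′)`) inherits an entry bound of `G`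
(the input of FILE 12 §5b's `sum2_attSK_le_of_entry_bound`). [cite: Balaban1983Higgs3, (2.10) p.426] -/
theorem abs_freeKernel_le {X : Type*} {N : ℕ} (G κ : X → X → ℝ) (hG : ∀ y y', |G y y'| ≤ κ y y')
    (p p' : X × Fin N) : |(if p.2 = p'.2 then G p.1 p'.1 else 0)| ≤ κ p.1 p'.1 := by
  split_ifs
  · exact hG _ _
  · rw [abs_zero]; exact (abs_nonneg _).trans (hG _ _)

/-- **B3 (2.10) p. 426 AT ZERO BACKGROUND ON THE (HIGGS)₂,₃ CARRIER — value and ONE differentiation (either end), hypothesis-free,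
uniform in the volume, the scale AND THE TOWER MASS `m′² ∈ [0, m₊²]`.**  For `d ≥ 1`, odd `L > 1`, `a > 0`, `m₊² ≥ 0` there are
`δ₁ > 0`, `C > 0` (functions of `d, L, a, m₊²`) such that for EVERY torus `P` of the model with a shape `S` of the sub-family (these
`d, L`), every tower mass `m′² ∈ [0, m₊²]`, every step `1 ≤ k ≤ K` (`η = L^{−k}`, `L^jη = (setupAt S k).spacing j`) and all `j`, `μ`,
sites — with `|x − x′| = η·tdist(x,x′)`, the printed torus distance (1.3) —:
(value) `|G^η_{(j)}(x,x′)| ≤ C(L^jη)^{2−d}e^{−δ₁(L^jη)^{−1}|x−x′|}`; (print's *"additional factor (L^jη)^{−1}"*, at either end)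
`|(∂^η_μG^η_{(j)})(x,x′)|, |(G^η_{(j)}∂^{η*}_μ)(y,x′)| ≤ C(L^jη)^{1−d}e^{…}` (FILE 6's `dKernelL` ∕ `dKernelR` with `η⁻¹`).  Sources: p33's
mass-window assembly `B3Ineq210RegularZeroBridge.ineq210_zeroTorus_massWindow` of p03's `ineq210_zeroTorus`, p20's `pieceT_symm`, p14's
`T_eSiteAt`. [cite: Balaban1983Higgs3, (2.10) p.426] -/
theorem gpieceH_bounds_massWindow (d L : ℕ) (hd : 1 ≤ d) (hL : Odd L ∧ 1 < L) {a : ℝ} (ha : 0 < a) {m2plus : ℝ}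
    (hm2 : 0 ≤ m2plus) :
    ∃ δ₁ C : ℝ, 0 < δ₁ ∧ 0 < C ∧ ∀ (P : HiggsLattice.Params) (S : Shape P), P.d = d → P.L = L →
      ∀ (msq : ℝ), 0 ≤ msq → msq ≤ m2plus → ∀ (k : ℕ) (hk : k ≤ P.K), 1 ≤ k →
        (∀ (j : ℕ) (x x' : HiggsLattice.Site P 0),
          |gpieceH S hk a msq j x x'| ≤
            C * (setupAt S k).spacing j ^ ((2 : ℝ) - (P.d : ℝ)) *
              Real.exp (-(δ₁ * ((setupAt S k).spacing j)⁻¹ *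
                ((setupAt S k).eps * (HiggsLattice.Site.tdist x x' : ℝ))))) ∧
        (∀ (j : ℕ) (μ : Fin P.d) (x x' : HiggsLattice.Site P 0),
          |dKernelL ((setupAt S k).eps)⁻¹ μ (gpieceH S hk a msq j) x x'| ≤
            C * (setupAt S k).spacing j ^ ((1 : ℝ) - (P.d : ℝ)) *
              Real.exp (-(δ₁ * ((setupAt S k).spacing j)⁻¹ *
                ((setupAt S k).eps * (HiggsLattice.Site.tdist x x' : ℝ))))) ∧
        (∀ (j : ℕ) (μ : Fin P.d) (y x' : HiggsLattice.Site P 0),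
          |dKernelR ((setupAt S k).eps)⁻¹ μ (gpieceH S hk a msq j) y x'| ≤
            C * (setupAt S k).spacing j ^ ((1 : ℝ) - (P.d : ℝ)) *
              Real.exp (-(δ₁ * ((setupAt S k).spacing j)⁻¹ *
                ((setupAt S k).eps * (HiggsLattice.Site.tdist y x' : ℝ))))) := by
  obtain ⟨δ₁, C, hδ₁, hC, h⟩ := ineq210_zeroTorus_massWindow d L hd hL ha hm2
  refine ⟨δ₁, C, hδ₁, hC, ?_⟩
  intro P S hPd hPL msq hmsq hcap k hk hk1
  -- the level-`k` `Setup` torus of the shape and p03's bound on it (over the mass window)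
  have hQd : (setupAt S k).d = d := hPd
  have hQL : (setupAt S k).L = L := hPL
  have H1 := h (setupAt S k) hQd hQL msq hmsq hcap k hk1 le_rfl
  have hεd : 0 ≤ ((setupAt S k).eps ^ P.d)⁻¹ := by have := (setupAt S k).eps_pos; positivity
  -- p03's carrier unpacked: `absG = η^{−d}|piece|`, `absDG = η^{−d}|∂piece|`, `scale = L^jη`, `dist = η·T`
  have hval : ∀ (j : ℕ) (z z' : Site (setupAt S k) 0),
      ((setupAt S k).eps ^ P.d)⁻¹ * |pieceT (setupAt S k) a msq k j z z'| ≤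
        C * (setupAt S k).spacing j ^ ((2 : ℝ) - (P.d : ℝ)) *
          Real.exp (-(δ₁ * ((setupAt S k).spacing j)⁻¹ * ((setupAt S k).eps * T (setupAt S k) 0 z z'))) :=
    fun j z z' => (H1 j z z').1
  have hder : ∀ (j : ℕ) (μ : Fin P.d) (z z' : Site (setupAt S k) 0),
      ((setupAt S k).eps ^ P.d)⁻¹ * |(deriv (setupAt S k) 0 (setupAt S k).eps μ * pieceT (setupAt S k) a msq k j) z z'| ≤
        C * (setupAt S k).spacing j ^ ((1 : ℝ) - (P.d : ℝ)) *
          Real.exp (-(δ₁ * ((setupAt S k).spacing j)⁻¹ * ((setupAt S k).eps * T (setupAt S k) 0 z z'))) :=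
    fun j μ z z' => (H1 j z z').2 μ
  -- the distance dictionary (1.3) ↔ the tower lineage's sup distance
  have hT : ∀ x x' : HiggsLattice.Site P 0,
      T (setupAt S k) 0 (eSiteAt S hk (Nat.zero_le k) x) (eSiteAt S hk (Nat.zero_le k) x') =
        (HiggsLattice.Site.tdist x x' : ℝ) := T_eSiteAt S hk (Nat.zero_le k)
  refine ⟨fun j x x' => ?_, fun j μ x x' => ?_, fun j μ y x' => ?_⟩
  · -- value
    rw [gpieceH_eq, abs_mul, abs_of_nonneg hεd]
    have hb := hval j (eSiteAt S hk (Nat.zero_le k) x) (eSiteAt S hk (Nat.zero_le k) x')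
    rw [hT] at hb
    exact hb
  · -- one differentiation at the first endpoint
    rw [dKernelL_gpieceH_eq_deriv, abs_mul, abs_of_nonneg hεd]
    have hb := hder j μ (eSiteAt S hk (Nat.zero_le k) x) (eSiteAt S hk (Nat.zero_le k) x')
    rw [hT] at hb
    exact hb
  · -- one differentiation at the second endpoint: the row difference at the swapped arguments (symmetry)
    rw [dKernelR_gpieceH_eq_deriv S hk ha hmsq, abs_mul, abs_of_nonneg hεd, tdist_comm y x']
    have hb := hder j μ (eSiteAt S hk (Nat.zero_le k) x') (eSiteAt S hk (Nat.zero_le k) y)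
    rw [hT] at hb
    exact hb

/-- **B3 (2.10) p. 426, THE CLAUSE WITH ONE DIFFERENTIATION AT EACH END, at zero background on the (Higgs)₂,₃ carrier**, hypothesis-free and
uniform in the volume and the scale (fixed tower mass `m′² ≥ 0`): `|(∂^η_μG^η_{(j)}∂^{η*}_{μ′})(x,x′)| ≤ C(L^jη)^{−d}e^{−δ₁(L^jη)^{−1}|x−x′|}`
(FILE 6's `d2KernelT` with `η⁻¹`; FILE 5's `dKernelT` is its diagonal, `dKernelT_gpieceH_eq_d2KernelT`).  Source: p20's
`B3Ineq210MixedTorus.ineq210_mixed_zeroTorus_rpow` (one mass; a mass-window re-assembly of p20's inputs, as p33 did for p03's, is not in the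
tree and not done here). [cite: Balaban1983Higgs3, (2.10) p.426] -/
theorem gpieceH_mixed_bound (d L : ℕ) (hd : 1 ≤ d) (hL : Odd L ∧ 1 < L) {a : ℝ} (ha : 0 < a) {msq : ℝ} (hmsq : 0 ≤ msq) :
    ∃ δ₁ C : ℝ, 0 < δ₁ ∧ 0 < C ∧ ∀ (P : HiggsLattice.Params) (S : Shape P), P.d = d → P.L = L →
      ∀ (k : ℕ) (hk : k ≤ P.K), 1 ≤ k →
        ∀ (j : ℕ) (μ μ' : Fin P.d) (x x' : HiggsLattice.Site P 0),
          |d2KernelT ((setupAt S k).eps)⁻¹ μ μ' (gpieceH S hk a msq j) x x'| ≤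
            C * (setupAt S k).spacing j ^ (-(P.d : ℝ)) *
              Real.exp (-(δ₁ * ((setupAt S k).spacing j)⁻¹ *
                ((setupAt S k).eps * (HiggsLattice.Site.tdist x x' : ℝ)))) := by
  obtain ⟨δ₁, C, hδ₁, hC, h⟩ := ineq210_mixed_zeroTorus_rpow d L hd hL ha hmsq
  refine ⟨δ₁, C, hδ₁, hC, ?_⟩
  intro P S hPd hPL k hk hk1 j μ μ' x x'
  have hQd : (setupAt S k).d = d := hPd
  have hQL : (setupAt S k).L = L := hPL
  have hεd : 0 ≤ ((setupAt S k).eps ^ P.d)⁻¹ := by have := (setupAt S k).eps_pos; positivity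
  have hmix : ∀ (z z' : Site (setupAt S k) 0),
      ((setupAt S k).eps ^ P.d)⁻¹ * |mixedT (setupAt S k) (setupAt S k).eps μ μ' (pieceT (setupAt S k) a msq k j) z z'| ≤
        C * (setupAt S k).spacing j ^ (-(P.d : ℝ)) *
          Real.exp (-(δ₁ * ((setupAt S k).spacing j)⁻¹ * ((setupAt S k).eps * T (setupAt S k) 0 z z'))) :=
    fun z z' => h (setupAt S k) hQd hQL k hk1 le_rfl j μ μ' z z'
  rw [d2KernelT_gpieceH_eq_mixedT, abs_mul, abs_of_nonneg hεd]
  have hb := hmix (eSiteAt S hk (Nat.zero_le k) x) (eSiteAt S hk (Nat.zero_le k) x')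
  rw [T_eSiteAt S hk (Nat.zero_le k)] at hb
  exact hb

/-- **(2.10) AT THE MODEL'S STEP-`k` DATA, constants uniform in `k`**: for the model's mass `m² ≥ 0` and every step `1 ≤ k ≤ K` with
`L^kε ≤ 1` the pieces `pieceH_j` of tower mass `m²(L^kε)²` — whose `(L^kε)²`-multiples `⊗ 1_N` ARE the pieces of record
`G^η_{(j)}(T_ε, 0)` (`opEntry_pieceA_zero`) — obey the value and one-differentiation bounds of (2.10) with `δ₁, C` depending on
`d, L, a, m²` only (the mass window `[0, m²]` of `gpieceH_bounds_massWindow`; cf. p33's `ineq210_regularTorus_zeroField`, the same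
statement in r14's carrier currency). [cite: Balaban1983Higgs3, (2.10) p.426] -/
theorem gpieceH_bounds_model (d L : ℕ) (hd : 1 ≤ d) (hL : Odd L ∧ 1 < L) {a : ℝ} (ha : 0 < a) {m2 : ℝ} (hm2 : 0 ≤ m2) :
    ∃ δ₁ C : ℝ, 0 < δ₁ ∧ 0 < C ∧ ∀ (P : HiggsLattice.Params) (S : Shape P), P.d = d → P.L = L →
      ∀ (k : ℕ) (hk : k ≤ P.K), 1 ≤ k → P.mesh k ≤ 1 →
        (∀ (j : ℕ) (x x' : HiggsLattice.Site P 0),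
          |gpieceH S hk a (m2 * P.mesh k ^ 2) j x x'| ≤
            C * (setupAt S k).spacing j ^ ((2 : ℝ) - (P.d : ℝ)) *
              Real.exp (-(δ₁ * ((setupAt S k).spacing j)⁻¹ *
                ((setupAt S k).eps * (HiggsLattice.Site.tdist x x' : ℝ))))) ∧
        (∀ (j : ℕ) (μ : Fin P.d) (x x' : HiggsLattice.Site P 0),
          |dKernelL ((setupAt S k).eps)⁻¹ μ (gpieceH S hk a (m2 * P.mesh k ^ 2) j) x x'| ≤
            C * (setupAt S k).spacing j ^ ((1 : ℝ) - (P.d : ℝ)) *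
              Real.exp (-(δ₁ * ((setupAt S k).spacing j)⁻¹ *
                ((setupAt S k).eps * (HiggsLattice.Site.tdist x x' : ℝ))))) ∧
        (∀ (j : ℕ) (μ : Fin P.d) (y x' : HiggsLattice.Site P 0),
          |dKernelR ((setupAt S k).eps)⁻¹ μ (gpieceH S hk a (m2 * P.mesh k ^ 2) j) y x'| ≤
            C * (setupAt S k).spacing j ^ ((1 : ℝ) - (P.d : ℝ)) *
              Real.exp (-(δ₁ * ((setupAt S k).spacing j)⁻¹ *
                ((setupAt S k).eps * (HiggsLattice.Site.tdist y x' : ℝ))))) := by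
  obtain ⟨δ₁, C, hδ₁, hC, h⟩ := gpieceH_bounds_massWindow d L hd hL ha hm2
  refine ⟨δ₁, C, hδ₁, hC, ?_⟩
  intro P S hPd hPL k hk hk1 hmesh
  have hm' : 0 ≤ m2 * P.mesh k ^ 2 := mul_nonneg hm2 (sq_nonneg _)
  have hcap : m2 * P.mesh k ^ 2 ≤ m2 := by
    have h1 : P.mesh k ^ 2 ≤ 1 := pow_le_one₀ (P.mesh_pos k).le hmesh
    calc m2 * P.mesh k ^ 2 ≤ m2 * 1 := mul_le_mul_of_nonneg_left h1 hm2
      _ = m2 := mul_one _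
  exact h P S hPd hPL (m2 * P.mesh k ^ 2) hm' hcap k hk hk1

end Bounds

/-! ## §5 Non-vacuity: the binders are inhabited -/

/-- A torus of the model in the sub-family: `d = 3`, `ε = 1/3`, `K = 1`, `L = 3`, `M = 1`, `L′_μ = 3` (so `M·L′_μ = L^1`, `L^1ε = 1`),
and its shape. [cite: Balaban1982Higgs1, (1.2) p.604] -/
def witnessParams : HiggsLattice.Params :=
  ⟨3, 1 / 3, 1, 3, 1, fun _ => 3, by norm_num, by norm_num, by norm_num, by norm_num, fun _ => by norm_num⟩

/-- The shape of the witness torus (`m = 1`, `L = 3` odd). [cite: Balaban1982Higgs1, (1.2) p.604] -/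
def witnessShape : Shape witnessParams := ⟨1, ⟨⟨1, rfl⟩, by decide⟩, fun _ => rfl⟩

/-- The constants exist and (2.10) holds on the (Higgs)₂,₃ carrier of an explicit torus at the model's step-`1` data (`a = 1`, `m² = 0`,
`k = K = 1`, `L^1ε = 1`). [cite: Balaban1983Higgs3, (2.10) p.426] -/
theorem gpieceH_bounds_witness :
    ∃ δ₁ C : ℝ, 0 < δ₁ ∧ 0 < C ∧ ∀ (j : ℕ) (x x' : HiggsLattice.Site witnessParams 0),
      |gpieceH witnessShape (k := 1) le_rfl 1 (0 * witnessParams.mesh 1 ^ 2) j x x'| ≤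
        C * (setupAt witnessShape 1).spacing j ^ ((2 : ℝ) - ((3 : ℕ) : ℝ)) *
          Real.exp (-(δ₁ * ((setupAt witnessShape 1).spacing j)⁻¹ *
            ((setupAt witnessShape 1).eps * (HiggsLattice.Site.tdist x x' : ℝ)))) := by
  obtain ⟨δ₁, C, hδ₁, hC, h⟩ := gpieceH_bounds_model 3 3 (by norm_num) ⟨⟨1, by decide⟩, by decide⟩ (a := 1) one_pos (m2 := 0) le_rfl
  have hmesh : witnessParams.mesh 1 ≤ 1 := by norm_num [HiggsLattice.Params.mesh, witnessParams]
  exact ⟨δ₁, C, hδ₁, hC, fun j x x' => (h witnessParams witnessShape rfl rfl 1 le_rfl le_rfl hmesh).1 j x x'⟩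


/-! ## §6 The VECTOR-field line kernel of the evaluator at zero background: `δ_{μμ′} ⊗` the same scalar pieces (`N = d`, zero charge) -/

section VectorLines

open Literature.MathematicalPhysics.QuantumFieldTheory.Balaban1983to89.B3GraphAmplitudeRules (bondEntry)

variable {P : HiggsLattice.Params} (S : Shape P) {k : ℕ} (hk : k ≤ P.K)

/-- **The tower's top propagator is symmetric on the identified sites**: `G_k(e x, e x′) = G_k(e x′, e x)` (`1 ≤ k`, `a > 0`, `m′² ≥ 0`;
the sum (2.6) of the symmetric pieces, `sum_pieceH` + `pieceH_symm`). [cite: Balaban1983Higgs3, (2.6) p.424] -/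
theorem towerG_eSiteAt_symm {a msq : ℝ} (ha : 0 < a) (hm : 0 ≤ msq) (hk1 : 1 ≤ k) (x x' : HiggsLattice.Site P 0) :
    (tower (setupAt S k) a msq).G k (eSiteAt S hk (Nat.zero_le k) x) (eSiteAt S hk (Nat.zero_le k) x') =
      (tower (setupAt S k) a msq).G k (eSiteAt S hk (Nat.zero_le k) x') (eSiteAt S hk (Nat.zero_le k) x) := by
  rw [← sum_pieceH S hk ha hm hk1, ← sum_pieceH S hk ha hm hk1]
  exact Finset.sum_congr rfl fun j _ => pieceH_symm S hk ha hm j x x'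

/-- **FILE 2's `bondEntry` of the tree's vector-field propagator `HiggsFluctMeasure.vecG` at zero background** ((I.2.20) with `N = d` and
the zero charge — [Balaban1982Higgs1] p. 608 *"taking N = d and an external vector field A = 0"*): `bondEntry (G_k) b b′ =
[μ(b) = μ(b′)]·(L^kε)²·G_k(e b₋, e b′₋)` — the hypothesis shape `Kv b b′ = [b.dir = b′.dir]·C(b.src, b′.src)`, `C` symmetric
(`towerG_eSiteAt_symm`), of the `_print` theorems of FILEs 11/13 (vector mass and `a` are the caller's parameters `m′²`, `a`).
[cite: Balaban1982Higgs1, (2.20) p.610] [cite: Balaban1983Higgs3, (1.22) p.416] -/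
theorem bondEntry_vecG_zero {a msq : ℝ} (hk1 : 1 ≤ k) (ha : 0 < a) (hmsq : 0 ≤ msq) (b b' : HiggsLattice.PBond P 0) :
    bondEntry (HiggsFluctMeasure.vecG P msq a k) b b' =
      if b.dir = b'.dir then
        P.mesh k ^ 2 * (tower (setupAt S k) a (msq * P.mesh k ^ 2)).G k (eSiteAt S hk (Nat.zero_le k) b.src) (eSiteAt S hk (Nat.zero_le k) b'.src)
      else 0 :=
  opEntry_propagatorK_zero S hk (B3MultiscaleFields.zeroCharge P.d) hk1 ha hmsq _ _

/-- The vector line kernel decomposed into scale pieces ((2.6), *"and the similar equality for the vector field propagator"* p. 424):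
`bondEntry (G_k) b b′ = [μ(b) = μ(b′)]·(L^kε)²·Σ_{j<k} pieceH_j(b₋, b′₋)`. [cite: Balaban1983Higgs3, (2.6) p.424] -/
theorem bondEntry_vecG_zero_pieces {a msq : ℝ} (hk1 : 1 ≤ k) (ha : 0 < a) (hmsq : 0 ≤ msq) (b b' : HiggsLattice.PBond P 0) :
    bondEntry (HiggsFluctMeasure.vecG P msq a k) b b' =
      if b.dir = b'.dir then P.mesh k ^ 2 * ∑ j ∈ Finset.range k, pieceH S hk a (msq * P.mesh k ^ 2) j b.src b'.src else 0 :=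
  opEntry_propagatorK_zero_pieces S hk (B3MultiscaleFields.zeroCharge P.d) hk1 ha hmsq _ _

/-- **The vector-field pieces of record at zero background** (r14's `pieceA` for `N = d`, zero charge, `A = 0`) on bonds:
`bondEntry (G^η_{(j)}) b b′ = [μ(b) = μ(b′)]·(L^kε)²·pieceH_j(b₋, b′₋)`. [cite: Balaban1983Higgs3, (2.6) p.424] -/
theorem bondEntry_pieceA_zero {a msq : ℝ} (hk1 : 1 ≤ k) (ha : 0 < a) (hmsq : 0 ≤ msq) (j : ℕ) (b b' : HiggsLattice.PBond P 0) :
    bondEntry (pieceA (B3MultiscaleFields.zeroCharge P.d) (0 : HiggsLattice.VecField P 0) msq a k j) b b' =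
      if b.dir = b'.dir then P.mesh k ^ 2 * pieceH S hk a (msq * P.mesh k ^ 2) j b.src b'.src else 0 :=
  opEntry_pieceA_zero S hk (B3MultiscaleFields.zeroCharge P.d) hk1 ha hmsq j _ _

include S hk in
/-- (2.6) of record for the vector line kernel, bondwise: `Σ_{j<k} bondEntry (G^η_{(j)}) = bondEntry (G_k)` (r14's `sum_pieceA` at `N = d`,
zero charge, `A = 0`; `L` odd `> 1` from the shape). [cite: Balaban1983Higgs3, (2.6) p.424] -/
theorem sum_bondEntry_pieceA {a msq : ℝ} (hm : 0 ≤ msq) (ha : 0 < a) (hk1 : 1 ≤ k) (b b' : HiggsLattice.PBond P 0) :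
    ∑ j ∈ Finset.range k, bondEntry (pieceA (B3MultiscaleFields.zeroCharge P.d) (0 : HiggsLattice.VecField P 0) msq a k j) b b' =
      bondEntry (HiggsFluctMeasure.vecG P msq a k) b b' :=
  sum_opEntry_pieceA hk (B3MultiscaleFields.zeroCharge P.d) 0 hm ha S.hL.2 hk1 _ _

end VectorLines

/-! ## §7 (v1.2) The clause with one differentiation at each end OVER A MASS WINDOW — p20's one-volume lemma re-assembled over the window
(as p33 did for p03's value ∕ one-differentiation clauses) — and its model corollary: all three differentiation patterns k-uniform -/

section MixedWindow

open B4Thm110ZeroTorus (kerBounds_torus)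
open B5Leaf237C0Torus (gamma0 dK0 gamma0_pos dK0_pos)
open B5Display136Torus (G0unit)
open B1Ineq225ZeroFieldTorus (G0unit_decay_cap)
open B4Ineq116Torus (spacing_le_spacing)
open B3Ineq210MixedTorus (abs_mixedPieceT_le_of)

/-- kernel: `(L^jη)^{−1}·(η|x−x′|_T) = |x−x′|_T/L^j`. [folklore] -/
private theorem scale_inv_mul_dist (Q : Params) (j : ℕ) (x x' : Site Q 0) :
    (Q.spacing j)⁻¹ * (Q.eps * T Q 0 x x') = T Q 0 x x' / (Q.L : ℝ) ^ j := by
  unfold Params.spacing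
  rw [mul_inv, mul_assoc, ← mul_assoc (Q.eps)⁻¹, inv_mul_cancel₀ Q.eps_pos.ne', one_mul, div_eq_inv_mul]

/-- **B3 (2.10), THE TWICE-DIFFERENTIATED CLAUSE, for p03's TORUS MODEL INSTANCE `A = B̃ = 0`, `Ω = T_η`, uniformly in the volume, the
scale AND THE MASS `0 ≤ m′² ≤ m₊²`**: `∃ δ₁ C > 0` (functions of `d, L, a, m₊²`) with
`η^{−d}|(∂^η_μG^η_{(j)}∂^{η*}_ν)(x,x′)| ≤ C(L^jη)^{−d}e^{−δ₁(L^jη)^{−1}|x−x′|}` for every volume `Q` with these `d, L`, every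
`1 ≤ k ≤ K`, every `m′² ∈ [0, m₊²]`, all `j, μ, ν, x, x′` — p20's `ineq210_mixed_zeroTorus` (one mass) re-assembled over the window from
the same located inputs (`B4Thm110ZeroTorus.kerBounds_torus` with the cap `m₊²`, `B1Ineq225ZeroFieldTorus.G0unit_decay_cap`, p20's
one-volume lemma `B3Ineq210MixedTorus.abs_mixedPieceT_le_of`), exactly as p33's `ineq210_zeroTorus_massWindow` re-assembles p03's.
Print: *"… and if the propagator is differentiated, then for each differentiation, there is an additional factor (L^jη)^{−1} on the
right side."* [cite: Balaban1983Higgs3, (2.10) p.426] -/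
theorem ineq210_mixed_zeroTorus_massWindow (d L : ℕ) (hd : 1 ≤ d) (hL : Odd L ∧ 1 < L) {a : ℝ} (ha : 0 < a) {m2plus : ℝ}
    (hm2 : 0 ≤ m2plus) :
    ∃ δ₁ C : ℝ, 0 < δ₁ ∧ 0 < C ∧ ∀ (Q : Params), Q.d = d → Q.L = L →
      ∀ msq : ℝ, 0 ≤ msq → msq ≤ m2plus → ∀ k : ℕ, 1 ≤ k → k ≤ Q.K →
        ∀ (j : ℕ) (μ ν : Fin Q.d) (x x' : Site Q 0),
          (Q.eps ^ Q.d)⁻¹ * |mixedT Q Q.eps μ ν (pieceT Q a msq k j) x x'| ≤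
            C * Q.spacing j ^ (-(Q.d : ℝ)) * Real.exp (-(δ₁ * (Q.spacing j)⁻¹ * (Q.eps * T Q 0 x x'))) := by
  obtain ⟨C, δ, hC, hδ, hK⟩ := kerBounds_torus d L hd hL ha m2plus
  -- the `j = 0` constants depend on `d, L, a, m₊²` only; read them off any volume with these `d, L`
  obtain ⟨P₀, hP₀d, hP₀L⟩ : ∃ P₀ : Params, P₀.d = d ∧ P₀.L = L := ⟨⟨d, L, 0, 0, hd, hL⟩, rfl, rfl⟩
  set C₀ := 2 / gamma0 L a with hC₀def
  set δ₀ := dK0 d L a m2plus with hδ₀def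
  have hC₀ : 0 ≤ C₀ := by
    rw [hC₀def, ← hP₀L]; exact (div_pos two_pos (gamma0_pos (P := P₀) ha)).le
  have hδ₀ : 0 < δ₀ := by rw [hδ₀def, ← hP₀d, ← hP₀L]; exact dK0_pos (P := P₀) ha hm2
  refine ⟨min δ₀ (δ / 2),
    4 * C₀ * Real.exp (2 * δ₀) + a ^ 2 * (C ^ 3 * B4Sect5Proof.latticeConst d (δ / 2) ^ 2 * Real.exp δ) + 1,
    lt_min hδ₀ (by positivity), by positivity, ?_⟩
  intro Q hQd hQL msq hmsq hcapm k _ hkK j μ ν x x'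
  have hkm : k ≤ Q.m + Q.K := hkK.trans (Nat.le_add_left _ _)
  have hcap : Q.spacing k ^ 2 * msq ≤ m2plus := by
    have hs1 : Q.spacing k ≤ 1 := by rw [← Q.spacing_K]; exact spacing_le_spacing Q hkK
    have hs0 := (Q.spacing_pos k).le
    calc Q.spacing k ^ 2 * msq ≤ 1 * msq := mul_le_mul_of_nonneg_right (pow_le_one₀ hs0 hs1) hmsq
      _ = msq := one_mul _
      _ ≤ m2plus := hcapm
  have hKB := hK Q hQd hQL msq hmsq k hkm hcap
  subst hQd hQL
  have hG0 : ∀ x x' : Site Q 0, |G0unit Q a msq x x'| ≤ C₀ * Real.exp (-(δ₀ * T Q 0 x x')) :=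
    fun x x' => G0unit_decay_cap (Q := Q) ha hmsq hcapm x x'
  have hsw : 0 ≤ (Q.spacing j ^ Q.d)⁻¹ := by have := Q.spacing_pos j; positivity
  rw [Real.rpow_neg (Q.spacing_pos j).le, Real.rpow_natCast, mul_assoc (min δ₀ (δ / 2)) ((Q.spacing j)⁻¹),
    scale_inv_mul_dist]
  refine (abs_mixedPieceT_le_of ha hmsq hkm hC hδ hC₀ hδ₀ hKB hG0 j μ ν x x').trans ?_
  exact mul_le_mul_of_nonneg_right (mul_le_mul_of_nonneg_right (by linarith) hsw) (Real.exp_pos _).le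

/-- **(2.10) with one differentiation at EACH end, at zero background on the (Higgs)₂,₃ carrier, OVER THE MASS WINDOW** `m′² ∈ [0, m₊²]`:
`|(∂^η_μG^η_{(j)}∂^{η*}_{μ′})(x,x′)| ≤ C(L^jη)^{−d}e^{−δ₁(L^jη)^{−1}|x−x′|}` (FILE 6's `d2KernelT` with `η⁻¹`), `δ₁, C` functions of
`d, L, a, m₊²` — the window twin of `gpieceH_mixed_bound`. [cite: Balaban1983Higgs3, (2.10) p.426] -/
theorem gpieceH_mixed_bound_massWindow (d L : ℕ) (hd : 1 ≤ d) (hL : Odd L ∧ 1 < L) {a : ℝ} (ha : 0 < a) {m2plus : ℝ}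
    (hm2 : 0 ≤ m2plus) :
    ∃ δ₁ C : ℝ, 0 < δ₁ ∧ 0 < C ∧ ∀ (P : HiggsLattice.Params) (S : Shape P), P.d = d → P.L = L →
      ∀ (msq : ℝ), 0 ≤ msq → msq ≤ m2plus → ∀ (k : ℕ) (hk : k ≤ P.K), 1 ≤ k →
        ∀ (j : ℕ) (μ μ' : Fin P.d) (x x' : HiggsLattice.Site P 0),
          |d2KernelT ((setupAt S k).eps)⁻¹ μ μ' (gpieceH S hk a msq j) x x'| ≤
            C * (setupAt S k).spacing j ^ (-(P.d : ℝ)) *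
              Real.exp (-(δ₁ * ((setupAt S k).spacing j)⁻¹ *
                ((setupAt S k).eps * (HiggsLattice.Site.tdist x x' : ℝ)))) := by
  obtain ⟨δ₁, C, hδ₁, hC, h⟩ := ineq210_mixed_zeroTorus_massWindow d L hd hL ha hm2
  refine ⟨δ₁, C, hδ₁, hC, ?_⟩
  intro P S hPd hPL msq hmsq hcap k hk hk1 j μ μ' x x'
  have hQd : (setupAt S k).d = d := hPd
  have hQL : (setupAt S k).L = L := hPL
  have hεd : 0 ≤ ((setupAt S k).eps ^ P.d)⁻¹ := by have := (setupAt S k).eps_pos; positivity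
  have hmix : ∀ (z z' : Site (setupAt S k) 0),
      ((setupAt S k).eps ^ P.d)⁻¹ * |mixedT (setupAt S k) (setupAt S k).eps μ μ' (pieceT (setupAt S k) a msq k j) z z'| ≤
        C * (setupAt S k).spacing j ^ (-(P.d : ℝ)) *
          Real.exp (-(δ₁ * ((setupAt S k).spacing j)⁻¹ * ((setupAt S k).eps * T (setupAt S k) 0 z z'))) :=
    fun z z' => h (setupAt S k) hQd hQL msq hmsq hcap k hk1 le_rfl j μ μ' z z'
  rw [d2KernelT_gpieceH_eq_mixedT, abs_mul, abs_of_nonneg hεd]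
  have hb := hmix (eSiteAt S hk (Nat.zero_le k) x) (eSiteAt S hk (Nat.zero_le k) x')
  rw [T_eSiteAt S hk (Nat.zero_le k)] at hb
  exact hb

/-- **(2.10) with one differentiation at each end AT THE MODEL'S STEP-`k` DATA, constants uniform in `k`**: for the model's mass
`m² ≥ 0` and every step `1 ≤ k ≤ K` with `L^kε ≤ 1`, the pieces of tower mass `m²(L^kε)²` obey the `(L^jη)^{−d}` bound with `δ₁, C`
functions of `d, L, a, m²` only — with `gpieceH_bounds_model` this is print's *"for each differentiation … an additional factor
(L^jη)^{−1}"* for all three patterns (none, one at either end, one at each end) at zero background, uniformly in the step.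
[cite: Balaban1983Higgs3, (2.10) p.426] -/
theorem gpieceH_mixed_bound_model (d L : ℕ) (hd : 1 ≤ d) (hL : Odd L ∧ 1 < L) {a : ℝ} (ha : 0 < a) {m2 : ℝ} (hm2 : 0 ≤ m2) :
    ∃ δ₁ C : ℝ, 0 < δ₁ ∧ 0 < C ∧ ∀ (P : HiggsLattice.Params) (S : Shape P), P.d = d → P.L = L →
      ∀ (k : ℕ) (hk : k ≤ P.K), 1 ≤ k → P.mesh k ≤ 1 →
        ∀ (j : ℕ) (μ μ' : Fin P.d) (x x' : HiggsLattice.Site P 0),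
          |d2KernelT ((setupAt S k).eps)⁻¹ μ μ' (gpieceH S hk a (m2 * P.mesh k ^ 2) j) x x'| ≤
            C * (setupAt S k).spacing j ^ (-(P.d : ℝ)) *
              Real.exp (-(δ₁ * ((setupAt S k).spacing j)⁻¹ *
                ((setupAt S k).eps * (HiggsLattice.Site.tdist x x' : ℝ)))) := by
  obtain ⟨δ₁, C, hδ₁, hC, h⟩ := gpieceH_mixed_bound_massWindow d L hd hL ha hm2
  refine ⟨δ₁, C, hδ₁, hC, ?_⟩
  intro P S hPd hPL k hk hk1 hmesh j μ μ' x x'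
  have hm' : 0 ≤ m2 * P.mesh k ^ 2 := mul_nonneg hm2 (sq_nonneg _)
  have hcap : m2 * P.mesh k ^ 2 ≤ m2 := by
    have h1 : P.mesh k ^ 2 ≤ 1 := pow_le_one₀ (P.mesh_pos k).le hmesh
    calc m2 * P.mesh k ^ 2 ≤ m2 * 1 := mul_le_mul_of_nonneg_left h1 hm2
      _ = m2 := mul_one _
  exact h P S hPd hPL (m2 * P.mesh k ^ 2) hm' hcap k hk hk1 j μ μ' x x'

end MixedWindow

end


/-! ## §8 Through the torus ∕ box seam (FILE 17 `B3Eq213TorusBoxSeam`): (2.10) at zero background in p19's `K_le` shape on half-torus blocks -/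

section Seam

open B3Ineq215 (Cube)
open B3Ineq213 (supDist pts)
open B3Eq213TorusBoxSeam (labelChart lineBound_labelChart_of_torusBound_setupAt)

/-- **B3 (2.10) p. 426 AT ZERO BACKGROUND, READ THROUGH THE LABEL CHART OF `T_η` ON BLOCKS IN THE HALF-TORUS = THE BODY OF p19's `Amp.K_le` ∕
FILE 12 §8's `K_le`** (value and one differentiation at either end; `δ₀ = δ₁∕2`, `a_l = 2 − d` resp. `1 − d`, `L^jη = L^j(L^k)^{−1}`): for `d ≥ 1`, odd
`L > 1`, `a > 0`, `m² ≥ 0` there are `δ₀ > 0`, `C > 0` such that for every torus of the model with a shape of the sub-family, every step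
`1 ≤ k ≤ K` with `L^kε ≤ 1`, all `j`, all block positions `z, z′` with `z_μ, z′_μ < L^{K−k}ML′_μ` and all points `ξ ∈ □⟨k,z⟩`, `ξ′ ∈ □⟨k,z′⟩`:
`|G^η_{(j)}(chart ξ, chart ξ′)| ≤ C (L^jη)^{2−d} exp[−2δ₀(L^jη)^{−1} η|ξ − ξ′|_∞]` and the two differentiated clauses with `(L^jη)^{1−d}` — FILE 16's
`gpieceH_bounds_model` composed with FILE 17's `lineBound_labelChart_of_torusBound_setupAt` (torus distance = box distance off the seam).
[cite: Balaban1983Higgs3, (2.10) p.426] [cite: Balaban1983Higgs3, (2.13) p.426] -/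
theorem gpieceH_lineBounds_halfTorus (d L : ℕ) (hd : 1 ≤ d) (hL : Odd L ∧ 1 < L) {a : ℝ} (ha : 0 < a) {m2 : ℝ} (hm2 : 0 ≤ m2) :
    ∃ δ₀ C : ℝ, 0 < δ₀ ∧ 0 < C ∧ ∀ (P : HiggsLattice.Params) (S : Shape P), P.d = d → P.L = L →
      ∀ (k : ℕ) (hk : k ≤ P.K), 1 ≤ k → P.mesh k ≤ 1 → ∀ (j : ℕ) (z z' : Fin P.d → ℕ),
        (∀ μ, z μ < P.halfPerDir k μ) → (∀ μ, z' μ < P.halfPerDir k μ) →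
        (∀ ξ ∈ pts P.L (⟨k, z⟩ : Cube P.d), ∀ ξ' ∈ pts P.L (⟨k, z'⟩ : Cube P.d),
          |gpieceH S hk a (m2 * P.mesh k ^ 2) j (labelChart P 0 ξ) (labelChart P 0 ξ')| ≤
            C * ((P.L : ℝ) ^ j * ((P.L : ℝ) ^ k)⁻¹) ^ ((2 : ℝ) - (P.d : ℝ)) *
              Real.exp (-(2 * (δ₀) / ((P.L : ℝ) ^ j * ((P.L : ℝ) ^ k)⁻¹) * (((P.L : ℝ) ^ k)⁻¹ * (supDist ξ ξ' : ℝ))))) ∧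
        (∀ (μ : Fin P.d), ∀ ξ ∈ pts P.L (⟨k, z⟩ : Cube P.d), ∀ ξ' ∈ pts P.L (⟨k, z'⟩ : Cube P.d),
          |dKernelL ((setupAt S k).eps)⁻¹ μ (gpieceH S hk a (m2 * P.mesh k ^ 2) j) (labelChart P 0 ξ) (labelChart P 0 ξ')| ≤
            C * ((P.L : ℝ) ^ j * ((P.L : ℝ) ^ k)⁻¹) ^ ((1 : ℝ) - (P.d : ℝ)) *
              Real.exp (-(2 * (δ₀) / ((P.L : ℝ) ^ j * ((P.L : ℝ) ^ k)⁻¹) * (((P.L : ℝ) ^ k)⁻¹ * (supDist ξ ξ' : ℝ))))) ∧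
        (∀ (μ : Fin P.d), ∀ ξ ∈ pts P.L (⟨k, z⟩ : Cube P.d), ∀ ξ' ∈ pts P.L (⟨k, z'⟩ : Cube P.d),
          |dKernelR ((setupAt S k).eps)⁻¹ μ (gpieceH S hk a (m2 * P.mesh k ^ 2) j) (labelChart P 0 ξ) (labelChart P 0 ξ')| ≤
            C * ((P.L : ℝ) ^ j * ((P.L : ℝ) ^ k)⁻¹) ^ ((1 : ℝ) - (P.d : ℝ)) *
              Real.exp (-(2 * (δ₀) / ((P.L : ℝ) ^ j * ((P.L : ℝ) ^ k)⁻¹) * (((P.L : ℝ) ^ k)⁻¹ * (supDist ξ ξ' : ℝ))))) := by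
  obtain ⟨δ₁, C, hδ₁, hC, h⟩ := gpieceH_bounds_model d L hd hL ha hm2
  refine ⟨δ₁ / 2, C, half_pos hδ₁, hC, fun P S hPd hPL k hk hk1 hmesh j z z' hz hz' => ⟨?_, fun μ => ?_, fun μ => ?_⟩⟩
  · exact lineBound_labelChart_of_torusBound_setupAt hk ((h P S hPd hPL k hk hk1 hmesh).1 j) hz hz'
  · exact lineBound_labelChart_of_torusBound_setupAt hk
      (G := dKernelL ((setupAt S k).eps)⁻¹ μ (gpieceH S hk a (m2 * P.mesh k ^ 2) j))
      ((h P S hPd hPL k hk hk1 hmesh).2.1 j μ) hz hz'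
  · exact lineBound_labelChart_of_torusBound_setupAt hk
      (G := dKernelR ((setupAt S k).eps)⁻¹ μ (gpieceH S hk a (m2 * P.mesh k ^ 2) j))
      ((h P S hPd hPL k hk hk1 hmesh).2.2 j μ) hz hz'

end Seam

end Literature.MathematicalPhysics.QuantumFieldTheory.Balaban1983to89.B3Ineq210ZeroHiggsTorus
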